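import Summits.CriticalPhenomena.PercolationContinuityZ3.Theorems.PercNearOneGluingNoHeavyLowerTailSahiTransportCheck

/-!
# `NoHeavyLowerTail` (crux stmt-CriticalPhenomena-4575), Sahi / Kahn positivity: PARAMETER-FREE transport certificates on a pattern cube —
# coefficient tables, the join–reduce rule, and the kernel check (computable part)

Support file (cell `prim-l12`, seat P3, gen 5; `--supports stmt-CriticalPhenomena-4575`).  Computable definitions only (no reals, no `sorry`).

A PARAMETER-FREE (reduced) transport certificate for an up-set `H` of patterns of `2^m` (bitmask `M` over the `2^m` points; point `x` = the
pattern whose coordinates are the binary digits of `x`; `D = Hᶜ`) is a table `c(η, ζ, T) ≥ 0` (`η ∈ D`, `ζ ∈ H`, `T ∈ H`, `η ⊆ T`,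
`Σ_T c(η,ζ,T) = 1`) defining the scaled transport measure `θδ·ρ(T) = Σ_{η,ζ} w(η) w(ζ) c(η,ζ,T)` for EVERY parameter vector at once
(`w` = product weight, `θ = w(H)`, `δ = w(D)`).  Condition (o) of `…SahiTransportRho.RhoCert` is then automatic (`η ⊆ T`), and each
(TC) row / capacity row (a) is a polynomial of multidegree `≤ 3` in the parameters with INTEGER coefficients (after scaling by `DEN`), whose
nonnegativity on `[0,1]^m` is implied by the nonnegativity of its `4^m` three-copy fibre sums = base-`2^σ` digits of one Kronecker number
(`…SahiTransportCheck.checkVec_sound`, `…CovTransferCertAlgebra`).  This file: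
* `jrTab m M` — the table of the JOIN–REDUCE RULE (this work): `η ~ w(·|D)`, `ζ ~ w(·|H)` independent, `G` uniform among the minimal
  elements of `H` below `ζ`, `T` uniform among the minimal elements of `H ∩ [η, η ∪ G]`; `c(η,ζ,T) = P(T | η, ζ)`, scaled by `DEN = 3600`;
* `structTab` — the structural test of a table (nonnegative, row sums `DEN`, support `η ⊆ T ∈ H`);
* `tcZ`/`aZ` — the Kronecker numbers of the scaled (TC) and capacity rows (with the per-event caches `prodTab`, `krF`, `krD`), `checkTab σ m M ct`
  — the digit test of every capacity row and every (TC) row `X ≤ Z` over the increasing bitmasks, and `checkJR σ m M := checkTab σ m M (jrTab m M)`.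
Soundness (the certified table yields `SahiTransportCert.TransportCert` at every parameter vector, hence Kahn's Conjecture 5 / Sahi's `C₃` for the
junta slot `H` and arbitrary increasing `U, V`) is the companion file.  Census (HOME run/shared/lean/prim/prim-l12/prim-l12-p3, gen 5): the
join–reduce table passes for all `18` nontrivial events of `2^3` and for `25` of the `28` `S₄`-types of `2^4` (all fibres `≥ 0`); the three graph types
`P₄`, `C₄`, triangle-plus-pendant need LP-fitted tables. [this work]
-/

namespace Summit.CriticalPhenomena.PercolationContinuityZ3.Theorems.SahiTransportJR

open SahiC3Cube SahiTransportCheck OneCutCert CovTransferCert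

/-! ## Patterns as numbers: order, minimal elements, the join–reduce table -/

/-- `x ⊆ y` for patterns coded as numbers. [this work] -/
def psub (x y : ℕ) : Bool := (x &&& y) == x

/-- The points (patterns) of a bitmask event, in increasing order. [this work] -/
def pts (m M : ℕ) : List ℕ := (List.range (2 ^ m)).filter fun x => M.testBit x

/-- The minimal elements (for `⊆`) of a list of patterns. [this work] -/
def minimals (l : List ℕ) : List ℕ := l.filter fun x => l.all fun y => !(psub y x && !(y == x))

/-- The minimal elements of `H` contained in `ζ` (the possible generators `G`). [this work] -/
def gens (m M ζ : ℕ) : List ℕ := minimals ((pts m M).filter fun x => psub x ζ)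

/-- The minimal elements of `H ∩ [η, top]`. [this work] -/
def reduce (m M η top : ℕ) : List ℕ := minimals ((pts m M).filter fun x => psub η x && psub x top)

/-- The join–reduce probability `c(η, ζ, T) ∈ ℚ` of ending at `T` from `(η, ζ)`. [this work] -/
def jrC (m M η ζ T : ℕ) : ℚ :=
  let gs := gens m M ζ
  (gs.map fun g =>
    let R := reduce m M η (η ||| g)
    if T ∈ R then (1 : ℚ) / ((gs.length : ℚ) * (R.length : ℚ)) else 0).sum

/-- The common denominator used for the tables: `lcm(1..6)^2 = 3600` (antichains of `2^4` have at most `6` elements). [this work] -/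
def DEN : ℕ := 3600

/-- The complement bitmask `D = Hᶜ`. [this work] -/
def cpl (m M : ℕ) : ℕ := fullN m ^^^ M

/-- A coefficient table: `ct[η][ζ][T] = DEN·c(η,ζ,T)`. [this work] -/
abbrev Tab := List (List (List ℤ))

/-- Table access with default `0`. [this work] -/
def get3 (t : Tab) (a b c : ℕ) : ℤ := ((t.getD a []).getD b []).getD c 0

/-- The join–reduce table (`DEN·c` as integers; entries with `η ∈ H` or `ζ ∉ H` are irrelevant and set to `0`). [this work] -/
def jrTab (m M : ℕ) : Tab :=
  (List.range (2 ^ m)).map fun η => (List.range (2 ^ m)).map fun ζ => (List.range (2 ^ m)).map fun T =>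
    if !(M.testBit η) && M.testBit ζ then (jrC m M η ζ T * DEN).num else 0

/-- STRUCTURAL TEST of a table: for `η ∉ H ∋ ζ` the entries are nonnegative, sum to `DEN`, and are supported on `T ∈ H` with `η ⊆ T`. [this work] -/
def structTab (m M : ℕ) (ct : Tab) : Bool :=
  (pts m (cpl m M)).all fun η => (pts m M).all fun ζ =>
    ((List.range (2 ^ m)).all fun T =>
      decide (0 ≤ get3 ct η ζ T) && (decide (get3 ct η ζ T = 0) || (psub η T && M.testBit T))) &&
    decide ((((List.range (2 ^ m)).map fun T => get3 ct η ζ T).sum) = (DEN : ℤ))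

/-- Integrality test of the join–reduce probabilities (denominators divide `DEN`). [this work] -/
def integralJR (m M : ℕ) : Bool :=
  (pts m (cpl m M)).all fun η => (pts m M).all fun ζ => (List.range (2 ^ m)).all fun T => decide ((jrC m M η ζ T * DEN).den = 1)

/-! ## Kronecker numbers of the scaled rows -/

/-- Cache of the products `K(2^η)·K(2^ζ)·K(full)` of singleton Kronecker numbers. [this work] -/
def prodTab (σ m : ℕ) : List (List ℤ) :=
  (List.range (2 ^ m)).map fun η => (List.range (2 ^ m)).map fun ζ =>
    (krT σ m (2 ^ η) : ℤ) * (krT σ m (2 ^ ζ) : ℤ) * (krT σ m (fullN m) : ℤ)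

/-- Cache access with default `0`. [this work] -/
def get2 (t : List (List ℤ)) (a b : ℕ) : ℤ := (t.getD a []).getD b 0

/-- The table mass sent into `K`: `Σ_{T ∈ H ∩ K} ct[η][ζ][T]`. [this work] -/
def massK (m M : ℕ) (ct : Tab) (K η ζ : ℕ) : ℤ := ((pts m (M &&& K)).map fun T => get3 ct η ζ T).sum

/-- The Kronecker number of `DEN·θδ·ρ(K)` (as the cubic `Σ_{η,ζ} c_{ηζ}(K)·w(η)w(ζ)·1`). [this work] -/
def rhoZ (m M : ℕ) (ct : Tab) (pt : List (List ℤ)) (K : ℕ) : ℤ :=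
  ((pts m (cpl m M)).map fun η => ((pts m M).map fun ζ => massK m M ct K η ζ * get2 pt η ζ).sum).sum

/-- The Kronecker number of the scaled (TC) row at `(X, Z)`:
`DEN·[(1+δ)(w(K) − w(X)w(Z) − w(D∩K)) + w(X)w(D∩Z) + w(Z)w(D∩X)] − DEN·θδρ(K)`, `K = X ∩ Z`, `1 + δ ↦ F·F + K(D)·F`. [this work] -/
def tcZ (σ m M : ℕ) (ct : Tab) (pt : List (List ℤ)) (kF kD : ℤ) (X Z : ℕ) : ℤ :=
  let D := cpl m M; let K := X &&& Z
  let kX : ℤ := krT σ m X; let kZ : ℤ := krT σ m Z; let kK : ℤ := krT σ m K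
  let kDK : ℤ := krT σ m (D &&& K); let kDZ : ℤ := krT σ m (D &&& Z); let kDX : ℤ := krT σ m (D &&& X)
  (DEN : ℤ) * (kF * kF * kK + kD * kF * kK - kF * kX * kZ - kD * kX * kZ - kF * kF * kDK - kD * kF * kDK + kX * kDZ * kF + kZ * kDX * kF)
    - rhoZ m M ct pt K

/-- The Kronecker number of the scaled capacity row at the pattern `t`: `DEN·(1+δ)·w(t) − DEN·θδρ({t})`. [this work] -/
def aZ (σ m M : ℕ) (ct : Tab) (pt : List (List ℤ)) (kF kD : ℤ) (t : ℕ) : ℤ :=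
  let kt : ℤ := krT σ m (2 ^ t)
  (DEN : ℤ) * (kF * kF * kt + kD * kF * kt) - rhoZ m M ct pt (2 ^ t)

/-- The digit test of one row number. [this work] -/
def rowOK (off : ℤ) (offN : ℕ) (Z : ℤ) : Bool :=
  decide (0 ≤ Z + off) && decide (((Z + off).toNat &&& offN) = offN)

/-- Coefficient budget: `Σ|coefficients| ≤ DEN·(8 + 4^m)` for every row. [this work] -/
def BND (m : ℕ) : ℕ := DEN * (8 + 4 ^ m)

/-- **The check of a parameter-free certificate table** for the pattern event `M` on `2^m`: size conditions of the digit test, structure of the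
table, every capacity row, and every (TC) row for `X ≤ Z` increasing bitmasks. [this work] -/
def checkTab (σ m M : ℕ) (ct : Tab) : Bool :=
  let pt := prodTab σ m
  let kF : ℤ := krT σ m (fullN m); let kD : ℤ := krT σ m (cpl m M)
  let off := offT σ m; let offN := off.toNat
  let ups := upsN m
  decide (0 < σ) && decide (BND m * 8 ^ m < 2 ^ (σ - 1)) && structTab m M ct &&
    ((pts m M).all fun t => rowOK off offN (aZ σ m M ct pt kF kD t)) &&
    (ups.all fun X => ups.all fun Z => decide (Z < X) || rowOK off offN (tcZ σ m M ct pt kF kD X Z))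

/-- The check of the join–reduce certificate for the pattern event `M`. [this work] -/
def checkJR (σ m M : ℕ) : Bool := integralJR m M && checkTab σ m M (jrTab m M)

end Summit.CriticalPhenomena.PercolationContinuityZ3.Theorems.SahiTransportJR
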